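import Literature.MathematicalPhysics.QuantumFieldTheory.Balaban1983to89.Beta.KernelWard

/-!
# `BalabanUV.Beta.FP.WardSandwichEngine` — road «FP» for binder row D1, sub-row H2-ASM-5a «layer b» (completion of the in-flight W2 `FP/PerfectPolarizationWard` under R-FP-33 (b);
# journal l.26457 ∕ l.26795, INTENT of this seat 2026-08-21T04:17Z), part 1∕2 — THE SANDWICH ENGINE: a two-sided inverse pair `(A, M)` on a masked block carries the
# COMMUTATOR LAW `D = c·(M ∘ Π_y − Π_y ∘ M)` to W2's Ward letter (W1) `(A ∘ D) ∘ A = A ∘ X − X ∘ A`, `X = −c·Π_y`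

HONEST DEPENDENCY (page 1, mandatory): continuum YM on T⁴ ⇐ BetaPertH ∧ nine spine estimates (0/9 proved); BetaPertH ⇐ (D1) ∧ (D4) ∧ CAP+tail;
G-an2-4 gates asym, D1 and NE2/3/4.  HONEST FRAMING (cell contract, verbatim): «discharging `BetaPertH` makes Bałaban's UV stability UNCONDITIONAL —
a real constructive-QFT result; it is NOT the continuum limit and NOT the Clay problem.»  THIS MODULE DISCHARGES NOTHING of the wall: [folklore] operator
algebra for the tree's kernel calculus (`ExpKernelCalculus.comp`, `KernelWard.Bdd`∕`Decays`∕`comp_sub_left∕right`) with ULTRA-LOCAL factors — masked site projections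
`projM m y` and the masked identity `idM m` ([our object] data defs) —: evaluation of compositions against them (finitely supported sums, no summability), the two
summability facts a bounded leg × a decaying form need, and the engine `sandwich_commutator`.  No `def … : Prop`, nothing cited, 0 sorry; 0∕4 row-D1 binders;
NOT (W1) for the road's objects (part 2 `FP/PerfectPolarizationWardLetters` instantiates at `A := Pker`, `M := MF` via (P-INV) ✓ `FP/PerfectPropagatorInverse`, and at
`A := G0ker`, `M := −Δ` via lit1's Poisson equation), NOT (K0), NOT D1, NOT BetaPertH, NOT continuum, NOT Clay.  «not in print; our bookkeeping».

ABSOLUTE RULE (cell charter, verbatim): «No internally-minted statement may enter as a cited fact. Every hypothesis is either kernel-proved in this package or a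
verbatim quotation of a PUBLISHED theorem with page reference. The manuscript(s) under audit are NOT citable for their own disputed steps — they are the thing
under adjudication; programme-internal (2001/route/tribunal) claims are never citable.»

CONTENT (generic lattice dimension `D`, finite fibre `Φ`).
* §1 [folklore] `comp_smul_right`, `comp_smul_left` (scalars pull out of `comp`; no summability).
* §2 [our object] `projM m y x z a b := [x = y][z = y][a = b]·m a`, `idM m x z a b := [x = z][a = b]·m a`; `biLoc_projM`; [folklore] EVALUATIONS `comp_projM` (`(K ∘ Π_y)(x,z,a,b) =
  [z = y]·K x y a b·m b`), `projM_comp`, `idM_comp`, `comp_idM`.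
* §3 [folklore] `comp_comp_projM` ∕ `projM_comp_comp` (associativity with an ultra-local outer factor, no summability), `comp_projM_comp_apply`, the slice summabilities
  (`Bdd A B`, `Decays M C δ`, `0 < δ`), `comp_AMprojM_A_apply`, `comp_AprojMM_A_apply` (one Fubini over the finite fibre), and **`sandwich_commutator`**:
  `Bdd A B → Decays M C δ → 0 < δ → (∀ a, m a·m a = m a) → comp A M = idM m → comp M A = idM m →`
  `comp (comp A (c • (comp M (projM m y) − comp (projM m y) M))) A = comp A ((−c) • projM m y) − comp ((−c) • projM m y) A`.
Provenance: G-an2-4 formalisation swarm seat b2b-balaban-gan24-formalise-leaf-02 gen 40 (prover-b2b-balaban-gan24-formalise-leaf-02-g40-0; cross-lane on road FP), 2026-08-21.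
-/

noncomputable section

namespace Summit.QuantumFields.BalabanUV.Beta.FP.WardSandwichEngine


open Finset
open scoped BigOperators
open Literature.MathematicalPhysics.QuantumFieldTheory.Balaban1983to89
open Literature.MathematicalPhysics.QuantumFieldTheory.Balaban1983to89.Beta
open B12Sec2to5 (l1 l1_nonneg)
open ExpKernelCalculus (MKer Site comp Decays BiLoc summable_exp_shift l1_sub_symm)
open KernelWard (Bdd comp_sub_right comp_sub_left)

variable {D : ℕ} {Φ : Type*} [Fintype Φ]

/-! ## §1 Scalars and composition -/

/-- [folklore] scalars pull out of composition on the right: `A ∘ (c • K) = c • (A ∘ K)` (no summability needed). -/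
theorem comp_smul_right (A K : MKer D Φ) (c : ℝ) : comp A (c • K) = c • comp A K := by
  funext x z a b
  show (∑' y, ∑ f, A x y a f * (c • K) y z f b) = c • ∑' y, ∑ f, A x y a f * K y z f b
  rw [smul_eq_mul, ← tsum_mul_left]
  refine tsum_congr fun y => ?_
  rw [Finset.mul_sum]
  refine Finset.sum_congr rfl fun f _ => ?_
  simp only [Pi.smul_apply, smul_eq_mul]
  ring

/-- [folklore] scalars pull out of composition on the left: `(c • K) ∘ A = c • (K ∘ A)`. -/
theorem comp_smul_left (K A : MKer D Φ) (c : ℝ) : comp (c • K) A = c • comp K A := by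
  funext x z a b
  show (∑' y, ∑ f, (c • K) x y a f * A y z f b) = c • ∑' y, ∑ f, K x y a f * A y z f b
  rw [smul_eq_mul, ← tsum_mul_left]
  refine tsum_congr fun y => ?_
  rw [Finset.mul_sum]
  refine Finset.sum_congr rfl fun f _ => ?_
  simp only [Pi.smul_apply, smul_eq_mul]
  ring

variable [DecidableEq Φ]

/-! ## §2 Masked site projections and the masked identity -/

/-- [our object] the MASKED SITE PROJECTION at `y`: `projM m y x z a b := [x = y][z = y][a = b]·m a`. -/
def projM (m : Φ → ℝ) (y : Site D) : MKer D Φ := fun x z a b => if x = y ∧ z = y ∧ a = b then m a else 0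

/-- [our object] the MASKED IDENTITY: `idM m x z a b := [x = z][a = b]·m a`. -/
def idM (m : Φ → ℝ) : MKer D Φ := fun x z a b => if x = z ∧ a = b then m a else 0

omit [Fintype Φ] in
/-- [our object] entries of `projM`. -/
theorem projM_apply (m : Φ → ℝ) (y x z : Site D) (a b : Φ) : projM m y x z a b = if x = y ∧ z = y ∧ a = b then m a else 0 := rfl

omit [Fintype Φ] in
/-- [our object] entries of `idM`. -/
theorem idM_apply (m : Φ → ℝ) (x z : Site D) (a b : Φ) : idM m x z a b = if x = z ∧ a = b then m a else 0 := rfl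

omit [Fintype Φ] in
/-- [our object] `projM` is bi-localised at `(y, y)` with constant `|m a|`-max… here: with any constant dominating `|m|`, for every rate `δ ≥ 0`. -/
theorem biLoc_projM {m : Φ → ℝ} {Cm : ℝ} (hm : ∀ a, |m a| ≤ Cm) (y : Site D) (δ : ℝ) : BiLoc (projM m y) y y Cm δ := by
  intro x z a b
  rw [projM_apply]
  split_ifs with h
  · rcases h with ⟨hx, hz, _⟩
    subst hx; subst hz
    have h0 : l1 ((0 : Site D)) = 0 := by simp [l1]
    rw [sub_self, h0, add_zero, mul_zero, Real.exp_zero, mul_one]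
    exact hm a
  · rw [abs_zero]
    exact mul_nonneg ((abs_nonneg _).trans (hm a)) (Real.exp_pos _).le

/-- [folklore] RIGHT composition with the projection EVALUATES: `(K ∘ Π_y)(x, z, a, b) = [z = y]·K x y a b·m b` (a finitely supported sum). -/
theorem comp_projM (K : MKer D Φ) (m : Φ → ℝ) (y x z : Site D) (a b : Φ) :
    comp K (projM m y) x z a b = if z = y then K x y a b * m b else 0 := by
  unfold comp
  rw [tsum_eq_single y]
  · rw [Finset.sum_eq_single b]
    · by_cases hz : z = y <;> simp [projM_apply, hz]
    · intro f _ hf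
      simp [projM_apply, hf]
    · intro h; exact absurd (Finset.mem_univ b) h
  · intro y' hy'
    refine Finset.sum_eq_zero fun f _ => ?_
    simp [projM_apply, hy']

/-- [folklore] LEFT composition with the projection EVALUATES: `(Π_y ∘ K)(x, z, a, b) = [x = y]·m a·K y z a b`. -/
theorem projM_comp (K : MKer D Φ) (m : Φ → ℝ) (y x z : Site D) (a b : Φ) :
    comp (projM m y) K x z a b = if x = y then m a * K y z a b else 0 := by
  unfold comp
  rw [tsum_eq_single y]
  · rw [Finset.sum_eq_single a]
    · by_cases hx : x = y <;> simp [projM_apply, hx]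
    · intro f _ hf
      simp [projM_apply, hf.symm]
    · intro h; exact absurd (Finset.mem_univ a) h
  · intro y' hy'
    refine Finset.sum_eq_zero fun f _ => ?_
    simp [projM_apply, hy']

/-- [folklore] LEFT composition with the masked identity: `(idM ∘ K)(x, z, a, b) = m a·K x z a b`. -/
theorem idM_comp (K : MKer D Φ) (m : Φ → ℝ) (x z : Site D) (a b : Φ) : comp (idM m) K x z a b = m a * K x z a b := by
  unfold comp
  rw [tsum_eq_single x]
  · rw [Finset.sum_eq_single a]
    · simp [idM_apply]
    · intro f _ hf
      simp [idM_apply, hf.symm]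
    · intro h; exact absurd (Finset.mem_univ a) h
  · intro y' hy'
    refine Finset.sum_eq_zero fun f _ => ?_
    simp [idM_apply, Ne.symm hy']

/-- [folklore] RIGHT composition with the masked identity: `(K ∘ idM)(x, z, a, b) = K x z a b·m b`. -/
theorem comp_idM (K : MKer D Φ) (m : Φ → ℝ) (x z : Site D) (a b : Φ) : comp K (idM m) x z a b = K x z a b * m b := by
  unfold comp
  rw [tsum_eq_single z]
  · rw [Finset.sum_eq_single b]
    · simp [idM_apply]
    · intro f _ hf
      simp [idM_apply, hf]
    · intro h; exact absurd (Finset.mem_univ b) h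
  · intro y' hy'
    refine Finset.sum_eq_zero fun f _ => ?_
    simp [idM_apply, hy']

/-! ## §3 The engine: a two-sided inverse pair `(A, M)` carries the commutator law to the Ward letter (W1) -/

section Engine

variable {A M : MKer D Φ} {m : Φ → ℝ} {B C δ : ℝ}

/-- [folklore] `A ∘ (M ∘ Π_y) = (A ∘ M) ∘ Π_y` — associativity with an ultra-local right factor (no summability needed). -/
theorem comp_comp_projM (A M : MKer D Φ) (m : Φ → ℝ) (y : Site D) : comp A (comp M (projM m y)) = comp (comp A M) (projM m y) := by
  funext x z a b
  rw [comp_projM]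
  unfold comp
  by_cases hz : z = y
  · rw [if_pos hz, ← tsum_mul_right]
    refine tsum_congr fun x' => ?_
    rw [Finset.sum_mul]
    refine Finset.sum_congr rfl fun f _ => ?_
    rw [show (∑' y_1, ∑ f_1, M x' y_1 f f_1 * projM m y y_1 z f_1 b) = comp M (projM m y) x' z f b from rfl, comp_projM, if_pos hz]
    ring
  · rw [if_neg hz]
    refine (tsum_congr fun x' => ?_).trans tsum_zero
    refine Finset.sum_eq_zero fun f _ => ?_
    rw [show (∑' y_1, ∑ f_1, M x' y_1 f f_1 * projM m y y_1 z f_1 b) = comp M (projM m y) x' z f b from rfl, comp_projM, if_neg hz, mul_zero]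

/-- [folklore] the entries of `A ∘ (Π_y ∘ M)`: `Σ_f A x y a f·(m f·M y z f b)` (a finitely supported sum). -/
theorem comp_projM_comp_apply (A M : MKer D Φ) (m : Φ → ℝ) (y x z : Site D) (a b : Φ) :
    comp A (comp (projM m y) M) x z a b = ∑ f, A x y a f * (m f * M y z f b) := by
  unfold comp
  rw [tsum_eq_single y]
  · refine Finset.sum_congr rfl fun f _ => ?_
    rw [show (∑' y_1, ∑ f_1, projM m y y y_1 f f_1 * M y_1 z f_1 b) = comp (projM m y) M y z f b from rfl, projM_comp, if_pos rfl]
  · intro x' hx'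
    refine Finset.sum_eq_zero fun f _ => ?_
    rw [show (∑' y_1, ∑ f_1, projM m y x' y_1 f f_1 * M y_1 z f_1 b) = comp (projM m y) M x' z f b from rfl, projM_comp, if_neg hx', mul_zero]

/-- [folklore] summability of the slices `x' ↦ Σ_f A x x' a f·(M ∘ Π_y) x' z f b` (bounded × decaying, finitely many `f`). -/
theorem summable_slice_A_MprojM (hA : Bdd A B) (hM : Decays M C δ) (hδ : 0 < δ) (m : Φ → ℝ) (y x z : Site D) (a b : Φ) :
    Summable fun x' : Site D => ∑ f, A x x' a f * comp M (projM m y) x' z f b := by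
  refine summable_sum fun f _ => ?_
  simp_rw [comp_projM]
  by_cases hz : z = y
  · simp_rw [if_pos hz]
    have hC : 0 ≤ C := hM.nonneg a
    have hB : 0 ≤ B := (abs_nonneg _).trans (hA x x a a)
    refine Summable.of_norm_bounded ((summable_exp_shift hδ y).mul_left (B * C * |m b|)) fun x' => ?_
    rw [Real.norm_eq_abs, abs_mul, abs_mul]
    calc |A x x' a f| * (|M x' y f b| * |m b|) ≤ B * (C * Real.exp (-δ * l1 (x' - y)) * |m b|) :=
          mul_le_mul (hA x x' a f) (mul_le_mul_of_nonneg_right (hM x' y f b) (abs_nonneg _)) (by positivity) hB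
      _ = B * C * |m b| * Real.exp (-δ * l1 (y - x')) := by rw [l1_sub_symm]; ring
  · simp_rw [if_neg hz, mul_zero]
    exact summable_zero

/-- [folklore] summability of the slices `x' ↦ Σ_f A x x' a f·(Π_y ∘ M) x' z f b` (finitely supported at `x' = y`). -/
theorem summable_slice_A_projMM (A M : MKer D Φ) (m : Φ → ℝ) (y x z : Site D) (a b : Φ) :
    Summable fun x' : Site D => ∑ f, A x x' a f * comp (projM m y) M x' z f b := by
  refine summable_of_ne_finset_zero (s := {y}) fun x' hx' => ?_
  rw [Finset.mem_singleton] at hx'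
  refine Finset.sum_eq_zero fun f _ => ?_
  rw [projM_comp, if_neg hx', mul_zero]

/-- [folklore] summability of the slices `z' ↦ Σ_g (A ∘ (M ∘ Π_y)) x z' a g·A z' z g b` (finitely supported at `z' = y`). -/
theorem summable_slice_AMprojM_A (A M : MKer D Φ) (m : Φ → ℝ) (y x z : Site D) (a b : Φ) :
    Summable fun z' : Site D => ∑ g, comp A (comp M (projM m y)) x z' a g * A z' z g b := by
  refine summable_of_ne_finset_zero (s := {y}) fun z' hz' => ?_
  rw [Finset.mem_singleton] at hz'
  refine Finset.sum_eq_zero fun g _ => ?_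
  rw [comp_comp_projM, comp_projM, if_neg hz', zero_mul]

omit [Fintype Φ] [DecidableEq Φ] in
/-- [folklore] one term: summability of `z' ↦ M y z' f g·A z' z g b` (decaying × bounded). -/
theorem summable_term_M_A (hA : Bdd A B) (hM : Decays M C δ) (hδ : 0 < δ) (y z : Site D) (f g b : Φ) :
    Summable fun z' : Site D => M y z' f g * A z' z g b := by
  have hC : 0 ≤ C := hM.nonneg f
  refine Summable.of_norm_bounded ((summable_exp_shift hδ y).mul_left (C * B)) fun z' => ?_
  rw [Real.norm_eq_abs, abs_mul]
  calc |M y z' f g| * |A z' z g b| ≤ C * Real.exp (-δ * l1 (y - z')) * B := mul_le_mul (hM y z' f g) (hA z' z g b) (abs_nonneg _) (by positivity)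
    _ = C * B * Real.exp (-δ * l1 (y - z')) := by ring

omit [DecidableEq Φ] in
/-- [folklore] for each fibre index, summability of `z' ↦ Σ_g M y z' f g·A z' z g b`. -/
theorem summable_slice_M_A (hA : Bdd A B) (hM : Decays M C δ) (hδ : 0 < δ) (y z : Site D) (f b : Φ) :
    Summable fun z' : Site D => ∑ g, M y z' f g * A z' z g b :=
  summable_sum fun g _ => summable_term_M_A hA hM hδ y z f g b

/-- [folklore] summability of the slices `z' ↦ Σ_g (A ∘ (Π_y ∘ M)) x z' a g·A z' z g b` (decaying in `z'` × bounded). -/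
theorem summable_slice_AprojMM_A (hA : Bdd A B) (hM : Decays M C δ) (hδ : 0 < δ) (m : Φ → ℝ) (y x z : Site D) (a b : Φ) :
    Summable fun z' : Site D => ∑ g, comp A (comp (projM m y) M) x z' a g * A z' z g b := by
  simp_rw [comp_projM_comp_apply, Finset.sum_mul]
  refine summable_sum fun g _ => summable_sum fun f _ => ?_
  refine ((summable_term_M_A hA hM hδ y z f g b).mul_left (A x y a f * m f)).congr fun z' => ?_
  ring

/-- [folklore] `((A ∘ (M ∘ Π_y)) ∘ A)(x, z, a, b) = [x = y]·m a·m a·A y z a b` when `A ∘ M = idM m`. -/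
theorem comp_AMprojM_A_apply (hAM : comp A M = idM m) (y x z : Site D) (a b : Φ) :
    comp (comp A (comp M (projM m y))) A x z a b = if x = y then m a * m a * A y z a b else 0 := by
  rw [comp_comp_projM, hAM]
  show (∑' z', ∑ g, comp (idM m) (projM m y) x z' a g * A z' z g b) = _
  simp_rw [idM_comp, projM_apply]
  rw [tsum_eq_single y]
  · rw [Finset.sum_eq_single a]
    · by_cases hx : x = y <;> simp [hx]
    · intro g _ hg
      simp [hg.symm]
    · intro h; exact absurd (Finset.mem_univ a) h
  · intro z' hz'
    refine Finset.sum_eq_zero fun g _ => ?_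
    simp [hz']

/-- [folklore] `((A ∘ (Π_y ∘ M)) ∘ A)(x, z, a, b) = [z = y]·A x y a b·m b·m b` when `M ∘ A = idM m` (one Fubini over a finite index). -/
theorem comp_AprojMM_A_apply (hA : Bdd A B) (hM : Decays M C δ) (hδ : 0 < δ) (hMA : comp M A = idM m) (y x z : Site D) (a b : Φ) :
    comp (comp A (comp (projM m y) M)) A x z a b = if z = y then A x y a b * (m b * m b) else 0 := by
  have hMA' : ∀ f, (∑' z', ∑ g, M y z' f g * A z' z g b) = idM m y z f b := fun f => by rw [← hMA]; rfl
  show (∑' z', ∑ g, comp A (comp (projM m y) M) x z' a g * A z' z g b) = _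
  simp_rw [comp_projM_comp_apply, Finset.sum_mul]
  rw [show (∑' z' : Site D, ∑ g, ∑ f, A x y a f * (m f * M y z' f g) * A z' z g b)
      = ∑' z' : Site D, ∑ f, ∑ g, A x y a f * (m f * M y z' f g) * A z' z g b from tsum_congr fun z' => Finset.sum_comm]
  rw [Summable.tsum_finsetSum (fun f _ => ?_)]
  · have e : ∀ f, (∑' z', ∑ g, A x y a f * (m f * M y z' f g) * A z' z g b) = A x y a f * m f * idM m y z f b := by
      intro f
      rw [← hMA' f, ← tsum_mul_left]
      refine tsum_congr fun z' => ?_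
      rw [Finset.mul_sum]
      refine Finset.sum_congr rfl fun g _ => ?_
      ring
    simp_rw [e, idM_apply]
    rw [Finset.sum_eq_single b]
    · by_cases hz : z = y
      · simp [hz]; ring
      · have : ¬ (y = z) := fun h => hz h.symm
        simp [hz, this]
    · intro f _ hf
      simp [hf]
    · intro h; exact absurd (Finset.mem_univ b) h
  · have h := (summable_slice_M_A hA hM hδ y z f b).mul_left (A x y a f * m f)
    refine h.congr fun z' => ?_
    rw [Finset.mul_sum]
    refine Finset.sum_congr rfl fun g _ => ?_
    ring

/-- [folklore] **THE ENGINE.**  If `A ∘ M = idM m = M ∘ A` (two-sided inverse on the masked block, `m² = m`), `A` bounded and `M` exponentially decaying, then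
the COMMUTATOR LAW `D = c·(M ∘ Π_y − Π_y ∘ M)` is carried by the `A`-sandwich to the Ward letter (W1): `(A ∘ D) ∘ A = A ∘ X − X ∘ A` with `X = −c·Π_y`. -/
theorem sandwich_commutator (hA : Bdd A B) (hM : Decays M C δ) (hδ : 0 < δ) (hm : ∀ a, m a * m a = m a)
    (hAM : comp A M = idM m) (hMA : comp M A = idM m) (c : ℝ) (y : Site D) :
    comp (comp A (c • (comp M (projM m y) - comp (projM m y) M))) A
      = comp A ((-c) • projM m y) - comp ((-c) • projM m y) A := by
  have hD : comp A (c • (comp M (projM m y) - comp (projM m y) M))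
      = c • (comp A (comp M (projM m y)) - comp A (comp (projM m y) M)) := by
    rw [comp_smul_right, comp_sub_right (summable_slice_A_MprojM hA hM hδ m y) (summable_slice_A_projMM A M m y)]
  rw [hD, comp_smul_left, comp_sub_left (summable_slice_AMprojM_A A M m y) (summable_slice_AprojMM_A hA hM hδ m y),
    comp_smul_right, comp_smul_left]
  funext x z a b
  simp only [Pi.sub_apply, Pi.smul_apply, smul_eq_mul]
  rw [comp_AMprojM_A_apply hAM, comp_AprojMM_A_apply hA hM hδ hMA, comp_projM, projM_comp, hm a, hm b]
  split_ifs <;> ring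

end Engine

end Summit.QuantumFields.BalabanUV.Beta.FP.WardSandwichEngine

end
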